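import Summits.BirchSwinnertonDyer.Rank1Residual.X11b.Three.KolyvaginShaFiniteThree
import Summits.BirchSwinnertonDyer.Rank1Residual.X11b.KolyvaginHGZOfKodairaNeronRat
import HarnessLib

/-!
# `Ш(E/K)[3^∞]` finite on X11b @ 3 ∩ (KN₃) with (KN₃) read off the ℚ-SIDE data — FIVE cite-only inputs AT `3`

Cell `b2b-bsdres`, team x11b3 (N8/O2); seat x11b3-p2 GEN 35 ((P2-PERPRIME), optional FILE 5; depends on GEN 34's
follow-up (ii) δ `X11b/KolyvaginHGZOfKodairaNeronRat`).  Summit-side THEOREM-ONLY file (no definition, no named fact, no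
`sorry`); `K : Type`; the literal prime `3`.

HONEST FRAMING (binding): **plumbing — ONE application.**  `X11b/Three/KolyvaginShaFiniteThree` states (KN₃) at the places
of `K` (`3 ∤ ord_w Δ_min(E/K)` at multiplicative `w`, no IV / IV* additive `w`); the census (x11b3-p2 GEN 34, `kn_census.tsv`:
870 / 1 684 TRUE-OPEN, EVIDENCE under recount requests l.2616) decides (KN₃) from Cremona's ℚ-data.  Under the Heegner
hypothesis the two agree place by place (δ: `KolyvaginHloc.kodairaSymbolAt_and_ordMinimalDiscriminant_eq_of_heegner`), so the
X11b @ 3 END is restated with `hKN3m` / `hKN3a` over `HeightOneSpectrum (𝓞 ℚ)`.  Labels {`hPT`, `hrec`, `hCM₃`, `h53₃`, `hγ₃`}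
VERBATIM those of `KolyvaginShaFiniteThree`; NO `hexc`, NO `hK1`; nothing discharged beyond `hGZ₃` on (KN₃); nothing booked;
no mark / label / count / tier moves; node `Three.HsiehDescentAt₃` and its FOUR antecedents untouched.

What is proved (namespace `…X11b.Three`): `sha_primary_finite_three_of_leafInputs_of_poitouTate_of_kodairaNeron_rat`,
`sha_primary_finite_three_of_classX11b_of_kodairaNeron_rat`.
References: [McCallumLMS1991] §1 Theorem (per prime); [GrossLMS1991] Thm. 1.3 (2), Prop. 6.2 (1); [SilvermanAEC2009]
Prop. VII.5.4 (a), Thm. VII.6.1.  presearch: `lean search 'kodairaNeron_rat'` → δ draft only (gen34); nothing minted.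
-/

noncomputable section

open scoped Classical
open WeierstrassCurve Field NumberField IsDedekindDomain
open Literature.NumberTheory.EllipticCurves Literature.NumberTheory.GaloisRepresentations
open Literature.NumberTheory.EllipticCurves.Rank1Residual
open Literature.NumberTheory.EllipticCurves.RingClassField
open Literature.NumberTheory.EllipticCurves.ModularForms
open Literature.NumberTheory.DiophantineGeometry Literature.NumberTheory.DiophantineGeometry.TateAlgorithm
open Summit.BirchSwinnertonDyer.Rank1Residual.X11b.KolyvaginAssembly

namespace Summit.BirchSwinnertonDyer.Rank1Residual.X11b.Three

-- `K : Type`: the tree's ring-class class field theory is universe `0`.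
variable {K : Type} [Field K] [NumberField K] {N : ℕ} {W : WeierstrassCurve ℚ}

/-- **`Ш(E/K)[3^∞]` finite on `3 ‖ N_E` from FIVE cite-only inputs AT `3` on (KN₃) read off the ℚ-SIDE (Cremona-table)
data** — `sha_primary_finite_three_of_leafInputs_of_poitouTate` with its label `hGZ` SUPPLIED by
`KolyvaginHloc.hGZ_of_kodairaNeron_three_rat` (x11b3-p2 GEN 34 follow-up (ii): Kodaira–Néron at `p = 3` with the `K`-side
hypotheses transported from `ℚ` under the Heegner hypothesis — bad places of `E/K` lie over `ℓ ∣ N`, split hence unramified,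
A233 `UnramifiedBaseChange…_holds`) under `hKN3m` (`3 ∤ ord_ℓ(Δ_min(E/ℚ))` at every multiplicative `ℓ`) and `hKN3a` (no
additive prime of `E/ℚ` of Kodaira type IV / IV*) — EXACTLY the census predicate (KN₃) of `gen34/kn_census.tsv`.  CONDITIONAL on
EXACTLY {`hPT`, `hrec`, `hCM`, `h53`, `hγ`} at `3` + `hN` + `hmult` + (KN₃)/ℚ; cite-only, NOT discharged except `hGZ`; NO `hexc`,
NO `hK1`; nothing booked; no mark; #(KN₃) not asserted.
[cite: McCallumLMS1991, §1 Theorem (Kolyvagin)] [cite: GrossLMS1991, Thm. 1.3 (2), Prop. 6.2 (1)]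
[cite: SilvermanAEC2009, Prop. VII.5.4 (a), Thm. VII.6.1] -/
theorem sha_primary_finite_three_of_leafInputs_of_poitouTate_of_kodairaNeron_rat [NeZero N]
    [W.IsGloballyMinimal]
    (hPT : Literature.NumberTheory.GaloisCohomology.poitouTate_sum_localTatePairing_eq_zero K)
    (hN : ∀ [W.IsElliptic], N = W.conductorNorm ℤ)
    (hmult : W.HasMultiplicativeReductionAtPrime 3)
    (hrec : heegnerPointOfConductor_one_galoisConj N W K)
    (hCM : ∀ [W.IsElliptic] (_hK : IsImaginaryQuadratic K) (_hH : SatisfiesHeegnerHypothesis N K)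
      (Dt : ModularParametrizationData W N) (β : ℤ) (ι : K →+* ℂ),
      (4 * N : ℤ) ∣ β ^ 2 - NumberField.discr K →
      ∀ {M : ℕ}, 1 ≤ M → ∀ (m : ℕ), Squarefree m →
      (∀ q ∈ m.primeFactors, IsKolyvaginPrime N W K 3 q ∧ FrobEqFrobInfty W K (3 ^ M) q) →
      ∃ y : (W.baseChange (ringClassField K ι m)).toAffine.Point,
        WeierstrassCurve.Affine.Point.map (W' := W) (ringClassField K ι m).subtype.toRatAlgHom y =
          heegnerPointComplexOfConductor Dt (NumberField.discr K) β m)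
    (h53 : ∀ [W.IsElliptic] (_hK : IsImaginaryQuadratic K) (_hH : SatisfiesHeegnerHypothesis N K)
      (Dt : ModularParametrizationData W N) (β : ℤ) (ι : K →+* ℂ) {M : ℕ}
      (_hM : 1 ≤ M) {n : ℕ} (_hn : Squarefree n)
      (_hKol : ∀ q ∈ n.primeFactors, IsKolyvaginPrime N W K 3 q ∧ FrobEqFrobInfty W K (3 ^ M) q)
      (d : (m : ℕ) → m ∣ n → KolyvaginHeegnerData Dt β ι m) (m : ℕ) (hm : m ∣ n)
      (τm : ringClassField K ι m ≃ₐ[ℚ] ringClassField K ι m),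
      (∀ x : ringClassField K ι m, ((τm x : ringClassField K ι m) : ℂ) = starRingEnd ℂ x) →
      ∃ σ' ∈ ringClassGal ι m, IsOfFinAddOrder
        (pointGalHom W (ringClassField K ι m) τm (d m hm).y -
          (-W.rootNumber) • pointGalHom W (ringClassField K ι m) σ' (d m hm).y))
    (hKN3m : ∀ [W.IsElliptic] (v : HeightOneSpectrum (𝓞 ℚ)),
      W.HasMultiplicativeReductionAt v → ¬ 3 ∣ W.ordMinimalDiscriminant v)
    (hKN3a : ∀ [W.IsElliptic] (v : HeightOneSpectrum (𝓞 ℚ)), W.HasAdditiveReductionAt v →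
      W.kodairaSymbolAt v ≠ KodairaSymbol.IV ∧ W.kodairaSymbolAt v ≠ KodairaSymbol.IVstar)
    (hγ : ∀ [W.IsElliptic] (_hK : IsImaginaryQuadratic K) (_hH : SatisfiesHeegnerHypothesis N K)
      (Dt : ModularParametrizationData W N) (β : ℤ) (ι : K →+* ℂ) {M : ℕ}
      (_hM : 1 ≤ M) {n : ℕ} (_hn : Squarefree n)
      (_hKol : ∀ q ∈ n.primeFactors, IsKolyvaginPrime N W K 3 q ∧ FrobEqFrobInfty W K (3 ^ M) q)
      (d : (m : ℕ) → m ∣ n → KolyvaginHeegnerData Dt β ι m)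
      (m : ℕ) (hm : m ∣ n) (ℓ : ℕ) (hℓ : ℓ ∈ m.primeFactors) [Fact ℓ.Prime]
      (hΔ : ¬ (ℓ : ℤ) ∣ minimalDiscriminantInt W) (φ₀ : absoluteGaloisGroup (ZMod ℓ)),
      (∀ x : AlgebraicClosure (ZMod ℓ), φ₀ • x = x ^ ℓ) →
      ∀ (hle : ringClassField K ι (m / ℓ) ≤ ringClassField K ι m)
        (γ : ringClassField K ι m ≃ₐ[ℚ] ringClassField K ι m), γ ∈ ringClassGal ι m →
        geomReduction hΔ ((RatClosure.pointsEquiv (K := K) W).symm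
            ((d m hm).toGeomPoints (pointGalHom W (ringClassField K ι m) γ (d m hm).y))) =
          φ₀ • geomReduction hΔ ((RatClosure.pointsEquiv (K := K) W).symm
            ((d m hm).toGeomPoints (pointGalHom W (ringClassField K ι m) γ
              (WeierstrassCurve.Affine.Point.map (W' := W)
                ((RingClassField.inclusion ι hle).restrictScalars ℚ)
                (d (m / ℓ)
                  ((Nat.div_dvd_of_dvd (Nat.dvd_of_mem_primeFactors hℓ)).trans hm)).y))))) :
    ∀ [W.IsElliptic] (_hK : IsImaginaryQuadratic K) (_hH : SatisfiesHeegnerHypothesis N K)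
      {P : (W.baseChange K).toAffine.Point} (_hP : IsHeegnerPoint N W K P)
      (_hnt : ¬ IsOfFinAddOrder P) (_hρ : W.HasSurjectiveModNGaloisRep 3),
      Set.Finite {c : (W.baseChange K).sha | ∃ j : ℕ, 3 ^ j • c = 0} := by
  intro _ hK hH P hP hnt hρ
  exact sha_primary_finite_three_of_leafInputs_of_poitouTate hPT hN hmult hrec hCM h53
    (@fun _ hK hH Dt _ ι _ _ _ hn hKol d ↦
      KolyvaginHloc.hGZ_of_kodairaNeron_three_rat hK hH ι Dt hn hKol d hKN3m hKN3a) hγ hK hH hP hnt hρ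

/-- **On the class X11b @ 3, `Ш(E/K)[3^∞]` is finite from FIVE cite-only inputs AT `3` on (KN₃)/ℚ** —
`sha_primary_finite_three_of_leafInputs_of_poitouTate_of_kodairaNeron_rat` for `(E, 3) ∈ ClassX11b W 3` (only `mult(3)` is
used) at `N = N_E`: for `K` imaginary quadratic with the Heegner hypothesis, `P` a non-torsion Heegner point and `ρ̄_{E,3}` onto
(the cell's atom `Surj`; its complement is the corner `¬Surj`).  CONDITIONAL on EXACTLY {`hPT`, `hrec`, `hCM`, `h53`, `hγ`} at `3`
+ `hN` + (KN₃)/ℚ; cite-only, NOT discharged; nothing booked; no mark / count / tier moves.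
[cite: McCallumLMS1991, §1 Theorem (Kolyvagin)] [cite: GrossLMS1991, Thm. 1.3 (2)] -/
theorem sha_primary_finite_three_of_classX11b_of_kodairaNeron_rat [NeZero N] [W.IsGloballyMinimal]
    (hW : ClassX11b W 3)
    (hPT : Literature.NumberTheory.GaloisCohomology.poitouTate_sum_localTatePairing_eq_zero K)
    (hN : ∀ [W.IsElliptic], N = W.conductorNorm ℤ)
    (hrec : heegnerPointOfConductor_one_galoisConj N W K)
    (hCM : ∀ [W.IsElliptic] (_hK : IsImaginaryQuadratic K) (_hH : SatisfiesHeegnerHypothesis N K)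
      (Dt : ModularParametrizationData W N) (β : ℤ) (ι : K →+* ℂ),
      (4 * N : ℤ) ∣ β ^ 2 - NumberField.discr K →
      ∀ {M : ℕ}, 1 ≤ M → ∀ (m : ℕ), Squarefree m →
      (∀ q ∈ m.primeFactors, IsKolyvaginPrime N W K 3 q ∧ FrobEqFrobInfty W K (3 ^ M) q) →
      ∃ y : (W.baseChange (ringClassField K ι m)).toAffine.Point,
        WeierstrassCurve.Affine.Point.map (W' := W) (ringClassField K ι m).subtype.toRatAlgHom y =
          heegnerPointComplexOfConductor Dt (NumberField.discr K) β m)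
    (h53 : ∀ [W.IsElliptic] (_hK : IsImaginaryQuadratic K) (_hH : SatisfiesHeegnerHypothesis N K)
      (Dt : ModularParametrizationData W N) (β : ℤ) (ι : K →+* ℂ) {M : ℕ}
      (_hM : 1 ≤ M) {n : ℕ} (_hn : Squarefree n)
      (_hKol : ∀ q ∈ n.primeFactors, IsKolyvaginPrime N W K 3 q ∧ FrobEqFrobInfty W K (3 ^ M) q)
      (d : (m : ℕ) → m ∣ n → KolyvaginHeegnerData Dt β ι m) (m : ℕ) (hm : m ∣ n)
      (τm : ringClassField K ι m ≃ₐ[ℚ] ringClassField K ι m),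
      (∀ x : ringClassField K ι m, ((τm x : ringClassField K ι m) : ℂ) = starRingEnd ℂ x) →
      ∃ σ' ∈ ringClassGal ι m, IsOfFinAddOrder
        (pointGalHom W (ringClassField K ι m) τm (d m hm).y -
          (-W.rootNumber) • pointGalHom W (ringClassField K ι m) σ' (d m hm).y))
    (hKN3m : ∀ [W.IsElliptic] (v : HeightOneSpectrum (𝓞 ℚ)),
      W.HasMultiplicativeReductionAt v → ¬ 3 ∣ W.ordMinimalDiscriminant v)
    (hKN3a : ∀ [W.IsElliptic] (v : HeightOneSpectrum (𝓞 ℚ)), W.HasAdditiveReductionAt v →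
      W.kodairaSymbolAt v ≠ KodairaSymbol.IV ∧ W.kodairaSymbolAt v ≠ KodairaSymbol.IVstar)
    (hγ : ∀ [W.IsElliptic] (_hK : IsImaginaryQuadratic K) (_hH : SatisfiesHeegnerHypothesis N K)
      (Dt : ModularParametrizationData W N) (β : ℤ) (ι : K →+* ℂ) {M : ℕ}
      (_hM : 1 ≤ M) {n : ℕ} (_hn : Squarefree n)
      (_hKol : ∀ q ∈ n.primeFactors, IsKolyvaginPrime N W K 3 q ∧ FrobEqFrobInfty W K (3 ^ M) q)
      (d : (m : ℕ) → m ∣ n → KolyvaginHeegnerData Dt β ι m)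
      (m : ℕ) (hm : m ∣ n) (ℓ : ℕ) (hℓ : ℓ ∈ m.primeFactors) [Fact ℓ.Prime]
      (hΔ : ¬ (ℓ : ℤ) ∣ minimalDiscriminantInt W) (φ₀ : absoluteGaloisGroup (ZMod ℓ)),
      (∀ x : AlgebraicClosure (ZMod ℓ), φ₀ • x = x ^ ℓ) →
      ∀ (hle : ringClassField K ι (m / ℓ) ≤ ringClassField K ι m)
        (γ : ringClassField K ι m ≃ₐ[ℚ] ringClassField K ι m), γ ∈ ringClassGal ι m →
        geomReduction hΔ ((RatClosure.pointsEquiv (K := K) W).symm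
            ((d m hm).toGeomPoints (pointGalHom W (ringClassField K ι m) γ (d m hm).y))) =
          φ₀ • geomReduction hΔ ((RatClosure.pointsEquiv (K := K) W).symm
            ((d m hm).toGeomPoints (pointGalHom W (ringClassField K ι m) γ
              (WeierstrassCurve.Affine.Point.map (W' := W)
                ((RingClassField.inclusion ι hle).restrictScalars ℚ)
                (d (m / ℓ)
                  ((Nat.div_dvd_of_dvd (Nat.dvd_of_mem_primeFactors hℓ)).trans hm)).y))))) :
    ∀ [W.IsElliptic] (_hK : IsImaginaryQuadratic K) (_hH : SatisfiesHeegnerHypothesis N K)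
      {P : (W.baseChange K).toAffine.Point} (_hP : IsHeegnerPoint N W K P)
      (_hnt : ¬ IsOfFinAddOrder P) (_hρ : W.HasSurjectiveModNGaloisRep 3),
      Set.Finite {c : (W.baseChange K).sha | ∃ j : ℕ, 3 ^ j • c = 0} :=
  sha_primary_finite_three_of_leafInputs_of_poitouTate_of_kodairaNeron_rat hPT hN hW.2.2.1 hrec hCM
    h53 hKN3m hKN3a hγ

end Summit.BirchSwinnertonDyer.Rank1Residual.X11b.Three

end
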